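import Summits.BirchSwinnertonDyer.Rank1Residual.P2.CMRankOneAtTwoHeegnerIndex
import HarnessLib

set_option linter.dupNamespace false -- namespace `…BirchSwinnertonDyer.BirchSwinnertonDyer…` is the cell's (D-0017 nested layout)
set_option autoImplicit false

/-!
# Route `GoldfeldAllTwistsTwoConverse`, crux twin″ `BSDTwoCMSevenAdditiveRankOne` (item 19140): NON-DEGENERACY of
# an admissible Heegner datum of a CM rank-one curve, granted the published binders — the preamble of both
# half-stubs of line «heegner-halves» and the kernel form of the «mis-sized stubs» diagnosis

Seat `leafhand-bsd-goldfeldalltwistst-2-g0` (prover, explicit unit), `--supports stmt-BirchSwinnertonDyer-19140`,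
sibling of `GoldfeldAllTwistsTwoConverseTwinHeegnerHalvesPlacement.lean` (p793889). Theorems only; no definition,
axiom, `sorry`, instance or notation. HONEST FRAMING: bookkeeping extracted from the proof of
`P2.shaAn_eq_heegnerIndexFormula_two` / `P2.twin_centralValue_eq_of_hasCM`, not progress on the crux; item 19140
is research-open and NOT closed here; BSD is proved for no curve by this file.

WHY. The two half-stubs `stub_heegnerIndexUpperAtTwo` / `stub_heegnerIndexLowerAtTwo` of the registered skeleton
bound `ord₂ #Ш(W)` against `ord₂ 𝔮`, `𝔮 = cmHeegnerIndexQuotient W K P c k Wd u =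
8 I² t_W² / (n k² t_K² c² w² q |u| c_W)` — a quotient of `Nat.card`s and indices that Lean evaluates to JUNK
(`I = 0`, `#Ш = 0`, `q = twinQuotient Wd = 0`, hence `𝔮 = 0`) exactly when `P` is torsion, `Ш(W)` is infinite,
or `Wd(ℚ)` / `Ш(Wd)` is infinite. This file proves, GRANTED the five published binders of
`P2.bsdp_two_iff_cmHeegnerIndex` (Gross–Zagier `gross_zagier N W K`, Kolyvagin `kolyvagin N W K`, GZK
`rank_eq_analyticRank_of_analyticRank_le_one`, modularity `hasEntireLFunction_rat`, Burungale–Flach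
`bsdTriple_of_hasCM_of_L_one_ne_zero`), that NONE of these branches occurs for an admissible datum of a CM curve
of analytic rank one (`heegnerDatum_nondegenerate_of_facts`): `P` has infinite order (Gross–Zagier:
`L'(E/K,1) = L'(E,1)·L(E^{(d_K)},1) ≠ 0`), `rank E(K) = 1` and `Ш(E)` finite (Kolyvagin), `rank E(ℚ) = 1` (GZK),
`[E(K) : ℤP] ≠ 0` (height–index relation), `Wd(ℚ)` and `Ш(Wd)` finite with `twinQuotient Wd ≠ 0` (Burungale–Flach
for the rank-zero CM twin), and therefore `𝔮 ≠ 0` for both admissible `k ∈ {1,2}` and `#Ш(W) ≠ 0`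
(`cmHeegnerIndexQuotient_ne_zero_of_facts`, `card_sha_ne_zero_of_facts`). Read contrapositively this is the
kernel form of the diagnosis filed on the item (evidence «stub-misstated», 2026-08-30): WITHOUT the binders — as
the halves are registered — a stub worker would have to re-prove exactly these consequences of Gross–Zagier and
Kolyvagin inside the stub; WITH them (proposed reshape `Cruxes/…/Lines/heegner_halves_v2.lean`) each half is the
bare open `2`-adic inequality between two valuations of non-zero quantities.

References: B. Gross, D. Zagier, Invent. Math. 84 (1986) Thm. I.6.3, V.§2 [GrossZagier1986]; B. Gross, *Kolyvagin's
work on modular elliptic curves* (1991) (1.1), Thm. 1.3 [Gross1991]; D. Burungale, M. Flach (2024) Thm. 1.1, Cor. 2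
[BurungaleFlach2024]; R. L. Miller, LMS J. Comput. Math. 14 (2011) §1 [Miller2011LMS].
-/

noncomputable section

open scoped Classical

open WeierstrassCurve NumberField Literature.NumberTheory.EllipticCurves
  Literature.NumberTheory.EllipticCurves.ModularForms
  Literature.NumberTheory.EllipticCurves.Rank1Residual
  Literature.NumberTheory.EllipticCurves.Rank1Residual.Typed
  Literature.NumberTheory.EllipticCurves.KrizLi2019
  Literature.NumberTheory.QuadraticFields

namespace Summit.BirchSwinnertonDyer.BirchSwinnertonDyer.Theorems.GoldfeldGoodTwists

open Summit.BirchSwinnertonDyer.Rank1Residual Summit.BirchSwinnertonDyer.Rank1Residual.P2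

/-- **Non-degeneracy of an admissible Heegner datum of a CM curve of analytic rank one, granted the published
binders.** Data as in `P2.bsdp_two_iff_cmHeegnerIndex`: `W/ℚ` globally minimal, CM, `ord_{s=1} L(E,s) = 1`; `K`
imaginary quadratic with the Heegner hypothesis for `N`; `P ∈ E(K)` the Heegner point of `(Dt, H, ι)`;
`L(E^{(d_K)},1) ≠ 0`; `Wd = Cd • E^{(d_K)}` globally minimal. Then: `P` has infinite order; `rank E(K) = 1`;
`rank E(ℚ) = 1`; `Ш(E)` is finite; `Wd(ℚ)` and `Ш(Wd)` are finite; the index `[E(K) : ℤP]` is non-zero; the twin's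
arithmetic quotient `#Ш(Wd)·∏c_ℓ(Wd)/#Wd(ℚ)²` is non-zero; and the `L`-free index quotient `𝔮` is non-zero for
`k = 1` and `k = 2`. [cite: Gross1991, (1.1) and Thm. 1.3] [cite: GrossZagier1986, Thm. I.6.3 and V.§2]
[cite: BurungaleFlach2024, Thm. 1.1 and Cor. 2] -/
theorem heegnerDatum_nondegenerate_of_facts
    (W : WeierstrassCurve ℚ) [W.IsElliptic] [W.IsGloballyMinimal]
    (N : ℕ) [NeZero N] (K : Type) [Field K] [NumberField K]
    (Dt : ModularParametrizationData W N) (H : HeegnerDatum N (NumberField.discr K)) (ι : K →+* ℂ)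
    (P : (W.baseChange K).toAffine.Point)
    (hGZ : gross_zagier N W K) (hKo : kolyvagin N W K)
    (hGZK : rank_eq_analyticRank_of_analyticRank_le_one) (hmod : hasEntireLFunction_rat)
    (hBF : bsdTriple_of_hasCM_of_L_one_ne_zero)
    (hcm : W.HasCM) (hK : IsImaginaryQuadratic K) (hHN : SatisfiesHeegnerHypothesis N K)
    (hP : WeierstrassCurve.Affine.Point.map ι.toRatAlgHom P = heegnerPointComplex Dt H)
    (hr : W.analyticRank = 1)
    (hLt : (W.quadraticTwist (NumberField.discr K : ℚ)).entireLFunction 1 ≠ 0)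
    (Wd : WeierstrassCurve ℚ) [Wd.IsElliptic] [Wd.IsGloballyMinimal] (Cd : VariableChange ℚ)
    (hWd : Cd • W.quadraticTwist (NumberField.discr K : ℚ) = Wd) :
    ¬ IsOfFinAddOrder P ∧ (W.baseChange K).mordellWeilRank = 1 ∧ W.mordellWeilRank = 1 ∧
      Finite W.sha ∧ Finite Wd.toAffine.Point ∧ Finite Wd.sha ∧
      (AddSubgroup.zmultiples P).index ≠ 0 ∧ twinQuotient Wd ≠ 0 ∧
      ∀ k : ℕ, (k = 1 ∨ k = 2) → cmHeegnerIndexQuotient W K P Dt.c k Wd Cd.u ≠ 0 := by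
  haveI hEK : (W.baseChange K).IsElliptic := isElliptic_baseChange' W K
  obtain ⟨h2, hKtc⟩ := hK
  have hD0 : (NumberField.discr K : ℚ) ≠ 0 := by exact_mod_cast NumberField.discr_ne_zero K
  haveI hEt : (W.quadraticTwist (NumberField.discr K : ℚ)).IsElliptic :=
    W.isElliptic_quadraticTwist hD0
  ---------------------------------------------------------------- `L`-values over `ℚ` and `K`
  have hL0 : W.entireLFunction 1 = 0 := entireLFunction_one_eq_zero_of_analyticRank_eq_one hr
  obtain ⟨-, hderiv⟩ := leadingLCoeff_eq_deriv_of_analyticRank_eq_one hr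
  have hprod := lDerivEK_eq_deriv_mul W K hmod hL0
  have hLK : LDerivEK W K ≠ 0 := by
    rw [hprod]; exact mul_ne_zero hderiv hLt
  ---------------------------------------------------------------- Heegner point non-torsion; Kolyvagin
  have hPH : IsHeegnerPoint N W K P := ⟨Dt, H, ι, hP⟩
  have hPinf : ¬ IsOfFinAddOrder P :=
    (lDerivEK_ne_zero_iff_not_isOfFinAddOrder W N K hGZ ⟨h2, hKtc⟩ hHN hPH).mp hLK
  obtain ⟨hrkK, hShaK⟩ := hKo ⟨h2, hKtc⟩ hHN hPH hPinf
  have hShaW : W.ShaFinite :=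
    Literature.NumberTheory.EllipticCurves.shaFinite_of_baseChange W K hShaK
  haveI hfinW : Finite W.sha := hShaW
  ---------------------------------------------------------------- GZK over `ℚ`
  have hrQ : W.mordellWeilRank = 1 := by rw [(hGZK W (le_of_eq hr)).1, hr]
  ---------------------------------------------------------------- the index, via the height–index relation
  obtain ⟨k₀, hk12₀, -, hheight⟩ :=
    exists_halvingIndex_canonicalHeight_eq_index_sq_mul_regulator W K h2 hrkK hrQ P hPinf
  have htK : 0 < (W.baseChange K).torsionOrder := (W.baseChange K).torsionOrder_pos_holds
  have hk₀ : 0 < k₀ := by rcases hk12₀ with rfl | rfl <;> norm_num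
  have hI0 : (AddSubgroup.zmultiples P).index ≠ 0 := by
    intro hI
    rw [hI] at hheight
    have h0 : (k₀ : ℝ) ^ 2 * ((W.baseChange K).torsionOrder : ℝ) ^ 2 * P.canonicalHeight = 0 := by
      rw [hheight]; simp
    have hh0 : P.canonicalHeight = 0 := by
      rcases mul_eq_zero.mp h0 with h' | h'
      · rcases mul_eq_zero.mp h' with h'' | h''
        · exact absurd (pow_eq_zero_iff two_ne_zero |>.mp h'') (by exact_mod_cast hk₀.ne')
        · exact absurd (pow_eq_zero_iff two_ne_zero |>.mp h'') (by exact_mod_cast htK.ne')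
      · exact h'
    exact hPinf ((Affine.Point.canonicalHeight_eq_zero_iff_holds P).mp hh0)
  ---------------------------------------------------------------- the twin (CM, analytic rank 0): Burungale–Flach
  have hcmd : Wd.HasCM := X12.hasCM_of_smul_quadraticTwist W hcm hD0 Wd Cd hWd
  have hLd : Wd.entireLFunction 1 ≠ 0 := by
    rw [← hWd, WeierstrassCurve.entireLFunction_smul]; exact hLt
  obtain ⟨hfinpt, hfind, hqd⟩ := twin_centralValue_eq_of_hasCM hBF hmod Wd hcmd hLd
  have hΩdC : (Wd.realPeriodRat : ℂ) ≠ 0 := by exact_mod_cast (Wd.realPeriodRat_pos_holds).ne'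
  have hq0 : twinQuotient Wd ≠ 0 := by
    intro h0
    rw [h0, Rat.cast_zero] at hqd
    exact div_ne_zero hLd hΩdC hqd
  ---------------------------------------------------------------- positivity of the remaining factors
  have hn : 0 < (W.baseChange ℝ).numRealComponents := by
    rcases numRealComponents_eq_one_or W with h' | h' <;> omega
  have htW : 0 < W.torsionOrder := W.torsionOrder_pos_holds
  have hcW : 0 < W.tamagawaProduct := W.tamagawaProduct_pos_holds
  have hcM : (Dt.c : ℚ) ≠ 0 := Int.cast_ne_zero.mpr Dt.maninConstant_ne_zero_holds
  have hw : 0 < Units.torsionOrder K := Units.torsionOrder_pos K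
  have huu : (Cd.u : ℚ) ≠ 0 := Cd.u.ne_zero
  refine ⟨hPinf, hrkK, hrQ, hfinW, hfinpt, hfind, hI0, hq0, fun k hk12 => ?_⟩
  have hk0 : (k : ℚ) ≠ 0 := by rcases hk12 with rfl | rfl <;> norm_num
  have hI' : ((AddSubgroup.zmultiples P).index : ℚ) ≠ 0 := by exact_mod_cast hI0
  have htW' : (W.torsionOrder : ℚ) ≠ 0 := by exact_mod_cast htW.ne'
  have hn' : ((W.baseChange ℝ).numRealComponents : ℚ) ≠ 0 := by exact_mod_cast hn.ne'
  have htK' : ((W.baseChange K).torsionOrder : ℚ) ≠ 0 := by exact_mod_cast htK.ne'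
  have hw' : (Units.torsionOrder K : ℚ) ≠ 0 := by exact_mod_cast hw.ne'
  have hcW' : (W.tamagawaProduct : ℚ) ≠ 0 := by exact_mod_cast hcW.ne'
  have hu' : |(Cd.u : ℚ)| ≠ 0 := abs_ne_zero.mpr huu
  unfold cmHeegnerIndexQuotient
  exact div_ne_zero (mul_ne_zero (mul_ne_zero (by norm_num) (pow_ne_zero _ hI')) (pow_ne_zero _ htW'))
    (mul_ne_zero (mul_ne_zero (mul_ne_zero (mul_ne_zero (mul_ne_zero (mul_ne_zero
      (mul_ne_zero hn' (pow_ne_zero _ hk0)) (pow_ne_zero _ htK')) (pow_ne_zero _ hcM))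
      (pow_ne_zero _ hw')) hq0) hu') hcW')

/-- **The `L`-free index quotient of an admissible datum is non-zero** (granted the five binders), for the
halvability value `k ∈ {1,2}`: so in both half-stubs of line «heegner-halves» `padicValRat 2 𝔮` is the valuation
of a NON-ZERO rational — no junk branch. [cite: GrossZagier1986, Thm. I.6.3] [cite: BurungaleFlach2024, Cor. 2] -/
theorem cmHeegnerIndexQuotient_ne_zero_of_facts
    (W : WeierstrassCurve ℚ) [W.IsElliptic] [W.IsGloballyMinimal]
    (N : ℕ) [NeZero N] (K : Type) [Field K] [NumberField K]
    (Dt : ModularParametrizationData W N) (H : HeegnerDatum N (NumberField.discr K)) (ι : K →+* ℂ)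
    (P : (W.baseChange K).toAffine.Point)
    (hGZ : gross_zagier N W K) (hKo : kolyvagin N W K)
    (hGZK : rank_eq_analyticRank_of_analyticRank_le_one) (hmod : hasEntireLFunction_rat)
    (hBF : bsdTriple_of_hasCM_of_L_one_ne_zero)
    (hcm : W.HasCM) (hK : IsImaginaryQuadratic K) (hHN : SatisfiesHeegnerHypothesis N K)
    (hP : WeierstrassCurve.Affine.Point.map ι.toRatAlgHom P = heegnerPointComplex Dt H)
    (hr : W.analyticRank = 1)
    (hLt : (W.quadraticTwist (NumberField.discr K : ℚ)).entireLFunction 1 ≠ 0)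
    (Wd : WeierstrassCurve ℚ) [Wd.IsElliptic] [Wd.IsGloballyMinimal] (Cd : VariableChange ℚ)
    (hWd : Cd • W.quadraticTwist (NumberField.discr K : ℚ) = Wd) (k : ℕ) (hk12 : k = 1 ∨ k = 2) :
    cmHeegnerIndexQuotient W K P Dt.c k Wd Cd.u ≠ 0 :=
  (heegnerDatum_nondegenerate_of_facts W N K Dt H ι P hGZ hKo hGZK hmod hBF hcm hK hHN hP hr hLt Wd Cd
    hWd).2.2.2.2.2.2.2.2 k hk12

/-- **`#Ш(W) ≠ 0` for the curve of an admissible datum** (granted the binders: Kolyvagin's finiteness transported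
from `E/K` to `E/ℚ`): so in both half-stubs `padicValNat 2 (Nat.card W.sha)` is the valuation of a POSITIVE
integer — no junk branch. [cite: Gross1991, Thm. 1.3] [cite: Kolyvagin1990, Thm. A] -/
theorem card_sha_ne_zero_of_facts
    (W : WeierstrassCurve ℚ) [W.IsElliptic] [W.IsGloballyMinimal]
    (N : ℕ) [NeZero N] (K : Type) [Field K] [NumberField K]
    (Dt : ModularParametrizationData W N) (H : HeegnerDatum N (NumberField.discr K)) (ι : K →+* ℂ)
    (P : (W.baseChange K).toAffine.Point)
    (hGZ : gross_zagier N W K) (hKo : kolyvagin N W K)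
    (hGZK : rank_eq_analyticRank_of_analyticRank_le_one) (hmod : hasEntireLFunction_rat)
    (hBF : bsdTriple_of_hasCM_of_L_one_ne_zero)
    (hcm : W.HasCM) (hK : IsImaginaryQuadratic K) (hHN : SatisfiesHeegnerHypothesis N K)
    (hP : WeierstrassCurve.Affine.Point.map ι.toRatAlgHom P = heegnerPointComplex Dt H)
    (hr : W.analyticRank = 1)
    (hLt : (W.quadraticTwist (NumberField.discr K : ℚ)).entireLFunction 1 ≠ 0)
    (Wd : WeierstrassCurve ℚ) [Wd.IsElliptic] [Wd.IsGloballyMinimal] (Cd : VariableChange ℚ)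
    (hWd : Cd • W.quadraticTwist (NumberField.discr K : ℚ) = Wd) :
    Nat.card W.sha ≠ 0 := by
  haveI : Finite W.sha := (heegnerDatum_nondegenerate_of_facts W N K Dt H ι P hGZ hKo hGZK hmod hBF
    hcm hK hHN hP hr hLt Wd Cd hWd).2.2.2.1
  exact (Nat.card_pos (α := W.sha)).ne'

end Summit.BirchSwinnertonDyer.BirchSwinnertonDyer.Theorems.GoldfeldGoodTwists

end
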